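import Mathlib.Analysis.Complex.ExponentialBounds
import Mathlib.Analysis.SpecialFunctions.Pow.Real
import HarnessLib

/-!
# Sliding-window witness: the numerical inequality (parameters and exponent count)

Topic `Literature/Computability/AlgebraicComplexity`; the pure real-analysis part of the
discharge of `Literature.Barriers.ValiantsHypothesis.DepthReductionChasmDepthFour`
(Kumar–Saraf 2017, Cor. 1.3) for the sliding-window witness (`SlidingWindowPolynomial.lean`,
`SlidingWindowBounds.lean`). Kumar–Saraf's proof of Thm. 8.10 ends (their §8.5, "putting it
together") with a comparison of the closed-form upper bound of eq. (4.1) against the closed-form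
lower bound of Lemmas 8.3–8.9; `core_bound` is that comparison for our witness, with every
analytic estimate made explicit (`(1+u)^k ≤ e^{uk}`, `log 2 ∈ (0.6931, 0.7)`), and stated over
abstract parameters subject to the hypotheses the concrete parameter choice satisfies.

## References

* M. Kumar, S. Saraf, *On the power of homogeneous depth 4 arithmetic circuits*, SIAM J. Comput.
  46 (2017) 336–387: §8.5 (proof of Thm. 8.10).
-/

noncomputable section

namespace Literature.Computability.AlgebraicComplexity

namespace SlidingWindow

open Real

/-! ### Elementary analysis -/

/-- `(1+u)^k ≤ e^{uk}` for `u ≥ 0`. [folklore] -/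
theorem one_add_pow_le_exp {u : ℝ} (hu : 0 ≤ u) (k : ℕ) : (1 + u) ^ k ≤ Real.exp (u * k) := by
  rw [mul_comm, Real.exp_nat_mul]
  exact pow_le_pow_left₀ (by linarith) (by linarith [Real.add_one_le_exp u]) k

/-- `(1-v)⁻¹ ≤ 1 + 2v` for `0 ≤ v ≤ 1/2`. [folklore] -/
theorem inv_one_sub_le {v : ℝ} (hv0 : 0 ≤ v) (hv : v ≤ 1 / 2) : (1 - v)⁻¹ ≤ 1 + 2 * v := by
  rw [inv_eq_one_div, div_le_iff₀ (by linarith)]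
  nlinarith

/-- `(1-v)^{-k} ≤ e^{2vk}` for `0 ≤ v ≤ 1/2`. [folklore] -/
theorem inv_one_sub_pow_le_exp {v : ℝ} (hv0 : 0 ≤ v) (hv : v ≤ 1 / 2) (k : ℕ) :
    (1 - v)⁻¹ ^ k ≤ Real.exp (2 * v * k) :=
  (pow_le_pow_left₀ (inv_nonneg.2 (by linarith)) (inv_one_sub_le hv0 hv) k).trans
    (one_add_pow_le_exp (by linarith) k)

/-- `e^u ≤ 3` for `u ≤ 1`. [folklore] -/
theorem exp_le_three {u : ℝ} (hu : u ≤ 1) : Real.exp u ≤ 3 :=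
  (Real.exp_le_exp.2 hu).trans Real.exp_one_lt_three.le

/-- `2^t ≤ (1 + 2/D)^a` once `7 t (D+2) ≤ 20 a` (as `log 2 < 0.7` and `log(1+u) ≥ u/(1+u)`):
the balance between the gap length `a` and the bias `1/D` of the shift degree. [folklore] -/
theorem two_pow_le_one_add_div_pow {D a t : ℕ} (hD : 0 < D) (h : (D + 2) * (7 * t) ≤ 20 * a) :
    (2 : ℝ) ^ t ≤ (1 + 2 / (D : ℝ)) ^ a := by
  have hD' : (0 : ℝ) < D := by exact_mod_cast hD
  have hDne : (D : ℝ) ≠ 0 := hD'.ne'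
  have hbase : (0 : ℝ) < 1 + 2 / D := by positivity
  have hbne : (1 : ℝ) + 2 / D ≠ 0 := hbase.ne'
  rw [← Real.exp_log (pow_pos hbase a), Real.log_pow, ← Real.exp_log (pow_pos two_pos t),
    Real.log_pow, Real.exp_le_exp]
  have hlog : 2 / ((D : ℝ) + 2) ≤ Real.log (1 + 2 / D) := by
    have h1 := Real.one_sub_inv_le_log_of_pos hbase
    have heq : 1 - (1 + 2 / (D : ℝ))⁻¹ = 2 / ((D : ℝ) + 2) := by
      field_simp
      ring
    rwa [heq] at h1
  have hh : (((D + 2) * (7 * t) : ℕ) : ℝ) ≤ ((20 * a : ℕ) : ℝ) := by exact_mod_cast h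
  push_cast at hh
  calc (t : ℝ) * Real.log 2 ≤ t * (7 / 10) :=
        mul_le_mul_of_nonneg_left (by linarith [Real.log_two_lt_d9]) (Nat.cast_nonneg t)
    _ ≤ a * (2 / ((D : ℝ) + 2)) := by
        rw [mul_div_assoc' (a : ℝ), le_div_iff₀ (by positivity)]
        nlinarith
    _ ≤ a * Real.log (1 + 2 / D) := mul_le_mul_of_nonneg_left hlog (Nat.cast_nonneg a)

/-- `e^u < 2^v` once `10⁴ u < 6931 v` (as `0.6931 < log 2`). [folklore] -/
theorem exp_lt_two_pow {u : ℝ} {v : ℕ} (h : u * 10000 < 6931 * v) :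
    Real.exp u < (2 : ℝ) ^ v := by
  rw [← Real.exp_log (pow_pos two_pos v), Real.log_pow, Real.exp_lt_exp]
  nlinarith [Real.log_two_gt_d9, mul_nonneg (Nat.cast_nonneg v : (0 : ℝ) ≤ v)
    (sub_nonneg.2 Real.log_two_gt_d9.le)]

/-! ### The comparison of the two closed forms -/

set_option maxHeartbeats 1000000 in
/-- **Kumar–Saraf 2017, §8.5 for the sliding-window witness (the exponent count).** With
`x = (A-m)/A ∈ [1/2 + 1/D, 1/2 + 1/D + 2/A]`, `θ = x⁻¹`, `μ = 2(1+η)`, `r = k+1` sites at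
distance `d ≥ t+1` (`n + t = d + (t+1) + (k d + L')`), the product of
the closed-form upper bound of `pspDim_upper` (without the common factor `C(A, m)`) and the
closed-form lower-bound denominators `E² Λ` of `Esum_le`, `Lsum_le'` is `< 2^{n+t} / n^{r+1}`,
provided the elementary parameter inequalities listed hold (they do for `t = 32 log₂ n`,
`r = √n/8`, `s = √n`, `1/D ≈ 0.35 t r/n`, `n` large: `SlidingWindowNumerics` below).
[cite: KumarSaraf2017, §8.5 (proof of Thm. 8.10)] -/
theorem core_bound {n t r k s d L' A m D l' Lg : ℕ} {x η ε' Λ₀ : ℝ}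
    (hr : r = k + 1) (hrn : r ≤ n) (htd : t + 1 ≤ d)
    (hnt : n + t = d + (t + 1) + (k * d + L'))
    (hxA : x = ((A : ℝ) - m) / A) (hA0 : 0 < A)
    (hxlo : 1 / 2 + 1 / (D : ℝ) ≤ x) (hxhi : x ≤ 1 / 2 + 1 / (D : ℝ) + 2 / (A : ℝ))
    (hD8 : 8 ≤ D) (hA16 : 16 ≤ A)
    (hη0 : 0 < η) (hηn : 2 * η * (n + t) ≤ 1)
    (hε'0 : 0 ≤ ε') (hε'n : ε' * (n + t) ≤ 1)
    (h2rsb : 2 * (r * s) * (n - r) ≤ A)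
    (h4P : 4 * ((r * s + (n - r)) + 2 * (r * s + r + t)) ≤ A)
    (hloss : (2 * ((r * s + (n - r) : ℕ) + 2 * (r * s + r + t : ℕ)) : ℝ) / D ≤ Λ₀)
    (hrs : r * s + 1 ≤ n) (hDn : D ≤ 2 * n) (hnL : n < 2 ^ (Lg + 1))
    (hfin : Real.exp (Λ₀ + 1) * 2 ^ (9 + 4 * k + (Lg + 1) * (5 * r + 2) + l' + 2 * t) <
      (2 : ℝ) ^ (2 * r * t)) :
    (2 : ℝ) ^ l' * ((r * s + 1) * ((((A + (n - r) : ℕ) : ℝ) - m) / m) ^ (r * s)) *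
        ((A : ℝ) / ((A : ℝ) - m)) ^ (n - r) *
      (x ^ n * (x⁻¹ * (2 * (2 * (1 + η)) ^ d / (2 * (1 + η) - x⁻¹)) *
        ((x⁻¹ * (3 * (2 * (1 + η)) ^ (d - t - 1) / (2 * (1 + η) - x⁻¹) ^ 2)) ^ k *
          (2 * (2 * (1 + η)) ^ L' / (2 * (1 + η) - x⁻¹))))) ^ 2 *
      ((1 - x) ^ (n - r) * ((1 - x)⁻¹ * (1 + ε')) ^ (n + t)) * (n : ℝ) ^ (r + 1) <
      (2 : ℝ) ^ (n + t) := by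
  -- ℕ bookkeeping
  obtain ⟨a, rfl⟩ : ∃ a, d = a + (t + 1) := ⟨d - (t + 1), by omega⟩
  have had : a + (t + 1) - t - 1 = a := by omega
  rw [had]
  set b := n - r with hb
  have hbn : n = b + r := by omega
  set P₁ := r * s + b with hP₁
  set P₂ := r * s + r + t with hP₂
  -- basic real facts
  have hA0' : (0 : ℝ) < A := by exact_mod_cast hA0
  have hD0' : (0 : ℝ) < D := by exact_mod_cast (show 0 < D by omega)
  have hD8' : (8 : ℝ) ≤ D := by exact_mod_cast hD8
  have hA16' : (16 : ℝ) ≤ A := by exact_mod_cast hA16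
  have hDinv : 1 / (D : ℝ) ≤ 1 / 8 := by
    rw [div_le_div_iff₀ hD0' (by norm_num)]; linarith
  have hAinv : 2 / (A : ℝ) ≤ 1 / 8 := by
    rw [div_le_div_iff₀ hA0' (by norm_num)]; linarith
  have hDinv0 : (0 : ℝ) < 1 / D := by positivity
  have hAinv0 : (0 : ℝ) ≤ 2 / A := by positivity
  set δ := x - 1 / 2 with hδ
  have hδlo : 1 / (D : ℝ) ≤ δ := by rw [hδ]; linarith
  have hδhi : δ ≤ 1 / (D : ℝ) + 2 / A := by rw [hδ]; linarith
  have hδ0 : 0 < δ := lt_of_lt_of_le hDinv0 hδlo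
  have hδ4 : δ ≤ 1 / 4 := by linarith
  have hx0 : 0 < x := by linarith
  have hx34 : x ≤ 3 / 4 := by linarith
  have hx1 : x < 1 := by linarith
  have h1x0 : 0 < 1 - x := by linarith
  have hx12 : 1 / 2 ≤ x := by linarith
  -- `x = (A - m)/A`: `m = A (1 - x)`
  have hmA : (m : ℝ) = A * (1 - x) := by rw [hxA]; field_simp; ring
  have hAmx : (A : ℝ) - m = A * x := by rw [hmA]; ring
  have hθA : (A : ℝ) / ((A : ℝ) - m) = x⁻¹ := by
    rw [hAmx, ← one_div, div_eq_div_iff (mul_pos hA0' hx0).ne' hx0.ne']; ring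
  rw [hθA]
  -- θ, μ, g
  set θ := x⁻¹ with hθ
  have hxθ_pow : ∀ j : ℕ, x ^ j * θ ^ j = 1 := fun j => by
    rw [← mul_pow, hθ, mul_inv_cancel₀ hx0.ne', one_pow]
  have hθ0 : 0 < θ := by rw [hθ]; positivity
  have hθ1 : 1 ≤ θ := by rw [hθ]; exact (one_le_inv₀ hx0).2 hx1.le
  have hθ43 : 4 / 3 ≤ θ := by
    rw [hθ, le_inv_comm₀ (by norm_num) hx0]; norm_num; linarith
  have hθle : θ ≤ 2 * D / (D + 2) := by
    rw [hθ, inv_le_comm₀ hx0 (by positivity), inv_div]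
    calc ((D : ℝ) + 2) / (2 * D) = 1 / 2 + 1 / D := by field_simp
      _ ≤ x := hxlo
  have hθ2 : θ < 2 := by
    have : 2 * (D : ℝ) / (D + 2) < 2 := by rw [div_lt_iff₀ (by positivity)]; linarith
    linarith
  set μ := 2 * (1 + η) with hμ
  have hμ2 : (2 : ℝ) ≤ μ := by rw [hμ]; linarith
  have hμ0 : 0 < μ := by linarith
  set g := μ - θ with hg
  have hg_lo : 4 / ((D : ℝ) + 2) ≤ g := by
    have h2 : (2 : ℝ) - 2 * D / (D + 2) = 4 / (D + 2) := by field_simp; ring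
    rw [hg]; linarith
  have hg0 : 0 < g := lt_of_lt_of_le (by positivity) hg_lo
  have hgne : g ≠ 0 := hg0.ne'
  have hginv : g⁻¹ ≤ (D : ℝ) / 2 := by
    rw [inv_le_comm₀ hg0 (by positivity), inv_div]
    calc (2 : ℝ) / D ≤ 4 / (D + 2) := by rw [div_le_div_iff₀ hD0' (by positivity)]; linarith
      _ ≤ g := hg_lo
  have hginv0 : 0 ≤ g⁻¹ := inv_nonneg.2 hg0.le
  -- `E` in product form
  set nf := a + (t + 1) + a * k + L' with hnf
  have hEb : x ^ n * (θ * (2 * μ ^ (a + (t + 1)) / g) *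
      ((θ * (3 * μ ^ a / g ^ 2)) ^ k * (2 * μ ^ L' / g))) =
      x ^ b * (4 * 3 ^ k) * μ ^ nf * g⁻¹ ^ (2 * k + 2) := by
    have h1 : x ^ n * θ ^ (k + 1) = x ^ b := by
      rw [hbn, pow_add, mul_assoc, ← hr, hxθ_pow r, mul_one]
    rw [← h1, hnf]
    ring
  rw [hEb]
  -- the pieces
  set ρ := (((A + b : ℕ) : ℝ) - m) / m with hρdef
  have hρ : ρ = x * (1 - x)⁻¹ * (1 + b / (x * A)) := by
    rw [hρdef, hmA]; push_cast; field_simp; ring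
  have hB1 : ρ ^ (r * s) ≤ x ^ (r * s) * (1 - x)⁻¹ ^ (r * s) * 3 := by
    rw [hρ, mul_pow, mul_pow]
    refine mul_le_mul_of_nonneg_left ?_ (by positivity)
    calc (1 + b / (x * A)) ^ (r * s) ≤ Real.exp (b / (x * A) * (r * s : ℕ)) :=
          one_add_pow_le_exp (by positivity) _
      _ ≤ 3 := exp_le_three ?_
    -- `b/(xA) · rs ≤ 2 rs b / A ≤ 1`
    have h1 : (b : ℝ) / (x * A) ≤ 2 * b / A := by
      rw [div_le_div_iff₀ (by positivity) hA0']
      have : (b : ℝ) * A * 1 ≤ b * A * (2 * x) :=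
        mul_le_mul_of_nonneg_left (by linarith) (by positivity)
      linarith
    have h2 : ((2 * (r * s) * b : ℕ) : ℝ) ≤ A := by exact_mod_cast h2rsb
    push_cast at h2
    calc (b : ℝ) / (x * A) * (r * s : ℕ) ≤ 2 * b / A * (r * s : ℕ) :=
          mul_le_mul_of_nonneg_right h1 (by positivity)
      _ = (2 * (r * s) * b) / A := by push_cast; ring
      _ ≤ 1 := by rw [div_le_one hA0']; exact h2
  have hB2 : (4 * (3 : ℝ) ^ k) ^ 2 ≤ 16 * 2 ^ (4 * k) := by
    rw [mul_pow, show (4 : ℝ) ^ 2 = 16 by norm_num, ← pow_mul, pow_mul (2 : ℝ) 4 k,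
      show (2 : ℝ) ^ 4 = 16 by norm_num, mul_comm k 2, pow_mul]
    exact mul_le_mul_of_nonneg_left (pow_le_pow_left₀ (by positivity)
      (by norm_num) k) (by norm_num)
  have hB3 : (μ ^ nf) ^ 2 ≤ (2 : ℝ) ^ (2 * nf) * 3 := by
    rw [← pow_mul, mul_comm nf 2, hμ, mul_pow]
    refine mul_le_mul_of_nonneg_left ?_ (by positivity)
    calc (1 + η) ^ (2 * nf) ≤ Real.exp (η * (2 * nf : ℕ)) := one_add_pow_le_exp hη0.le _
      _ ≤ 3 := exp_le_three ?_
    have hnf_le : nf ≤ n + t := by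
      have e1 : k * (a + (t + 1)) = a * k + k * (t + 1) := by ring
      rw [hnf]; omega
    have h2nf : (nf : ℝ) ≤ n + t := by exact_mod_cast hnf_le
    calc η * ((2 * nf : ℕ) : ℝ) = 2 * η * nf := by push_cast; ring
      _ ≤ 2 * η * (n + t) := mul_le_mul_of_nonneg_left h2nf (by positivity)
      _ ≤ 1 := hηn
  have hB4 : g⁻¹ ^ (2 * k + 2) ≤ ((D : ℝ) / 2) ^ (2 * k + 2) := pow_le_pow_left₀ hginv0 hginv _
  have hB5 : (1 + ε') ^ (n + t) ≤ 3 := by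
    calc (1 + ε') ^ (n + t) ≤ Real.exp (ε' * (n + t : ℕ)) := one_add_pow_le_exp hε'0 _
      _ ≤ 3 := exp_le_three (by push_cast; exact hε'n)
  -- cancellations
  have hc1 : θ ^ b * (x ^ b) ^ 2 = x ^ b := by
    rw [sq, ← mul_assoc, mul_comm (θ ^ b), hxθ_pow b, one_mul]
  have hc2 : (1 - x) ^ b * (1 - x)⁻¹ ^ (n + t) = (1 - x)⁻¹ ^ (r + t) := by
    rw [show n + t = b + (r + t) by omega, pow_add, ← mul_assoc, ← mul_pow,
      mul_inv_cancel₀ h1x0.ne', one_pow, one_mul]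
  -- the product estimate
  have hLHS : (2 : ℝ) ^ l' * ((r * s + 1) * ρ ^ (r * s)) * θ ^ b *
      (x ^ b * (4 * 3 ^ k) * μ ^ nf * g⁻¹ ^ (2 * k + 2)) ^ 2 *
      ((1 - x) ^ b * ((1 - x)⁻¹ * (1 + ε')) ^ (n + t)) * (n : ℝ) ^ (r + 1) ≤
      432 * ((r * s + 1) * 2 ^ (4 * k) * (((D : ℝ) / 2) ^ (2 * k + 2)) ^ 2 * (n : ℝ) ^ (r + 1)) *
        2 ^ l' * 2 ^ (2 * nf) * (x ^ P₁ * (1 - x)⁻¹ ^ P₂) := by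
    calc (2 : ℝ) ^ l' * ((r * s + 1) * ρ ^ (r * s)) * θ ^ b *
        (x ^ b * (4 * 3 ^ k) * μ ^ nf * g⁻¹ ^ (2 * k + 2)) ^ 2 *
        ((1 - x) ^ b * ((1 - x)⁻¹ * (1 + ε')) ^ (n + t)) * (n : ℝ) ^ (r + 1)
        = (2 : ℝ) ^ l' * (r * s + 1) * ρ ^ (r * s) * (θ ^ b * (x ^ b) ^ 2) *
          (4 * 3 ^ k) ^ 2 * (μ ^ nf) ^ 2 * (g⁻¹ ^ (2 * k + 2)) ^ 2 *
          ((1 - x) ^ b * (1 - x)⁻¹ ^ (n + t)) * (1 + ε') ^ (n + t) * (n : ℝ) ^ (r + 1) := by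
          rw [mul_pow ((1 - x)⁻¹) (1 + ε') (n + t)]; ring
      _ = (2 : ℝ) ^ l' * (r * s + 1) * ρ ^ (r * s) * x ^ b *
          (4 * 3 ^ k) ^ 2 * (μ ^ nf) ^ 2 * (g⁻¹ ^ (2 * k + 2)) ^ 2 *
          (1 - x)⁻¹ ^ (r + t) * (1 + ε') ^ (n + t) * (n : ℝ) ^ (r + 1) := by rw [hc1, hc2]
      _ ≤ (2 : ℝ) ^ l' * (r * s + 1) * (x ^ (r * s) * (1 - x)⁻¹ ^ (r * s) * 3) * x ^ b *
          (16 * 2 ^ (4 * k)) * ((2 : ℝ) ^ (2 * nf) * 3) * (((D : ℝ) / 2) ^ (2 * k + 2)) ^ 2 *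
          (1 - x)⁻¹ ^ (r + t) * 3 * (n : ℝ) ^ (r + 1) := by
          gcongr
      _ = _ := by rw [hP₁, hP₂, pow_add, pow_add, pow_add]; ring
  -- constants: `432 (rs+1) 16^k (D/2)^{4r} n^{r+1} ≤ 2^{9 + 4k + (Lg+1)(5r+2)}`
  have hK : 432 * ((r * s + 1) * (2 : ℝ) ^ (4 * k) * (((D : ℝ) / 2) ^ (2 * k + 2)) ^ 2 *
      (n : ℝ) ^ (r + 1)) ≤ 2 ^ (9 + 4 * k + (Lg + 1) * (5 * r + 2)) := by
    have hn1 : (r * s + 1 : ℝ) ≤ n := by exact_mod_cast hrs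
    have hD2n : (D : ℝ) / 2 ≤ n := by
      rw [div_le_iff₀ two_pos]; exact_mod_cast (by omega : D ≤ n * 2)
    have hn2 : (n : ℝ) ≤ 2 ^ (Lg + 1) := by exact_mod_cast hnL.le
    have h1 : (((D : ℝ) / 2) ^ (2 * k + 2)) ^ 2 ≤ (n : ℝ) ^ (4 * k + 4) := by
      rw [← pow_mul, show (2 * k + 2) * 2 = 4 * k + 4 by ring]
      exact pow_le_pow_left₀ (by positivity) hD2n _
    calc 432 * ((r * s + 1) * (2 : ℝ) ^ (4 * k) * (((D : ℝ) / 2) ^ (2 * k + 2)) ^ 2 * (n : ℝ) ^ (r + 1))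
        ≤ 2 ^ 9 * ((n : ℝ) * (2 : ℝ) ^ (4 * k) * (n : ℝ) ^ (4 * k + 4) * (n : ℝ) ^ (r + 1)) := by
          gcongr; norm_num
      _ = 2 ^ 9 * 2 ^ (4 * k) * (n : ℝ) ^ (5 * r + 2) := by
          rw [hr]; ring
      _ ≤ 2 ^ 9 * 2 ^ (4 * k) * ((2 : ℝ) ^ (Lg + 1)) ^ (5 * r + 2) := by
          gcongr
      _ = 2 ^ (9 + 4 * k + (Lg + 1) * (5 * r + 2)) := by ring
  -- the `δ`-losses: `x^{P₁} 2^{P₁} ≤ e^{2δP₁}`, `(1-x)^{-P₂} ≤ 2^{P₂} e^{4δP₂}`, total `≤ e^{rt+1}`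
  have hL1 : x ^ P₁ * 2 ^ P₁ ≤ Real.exp (2 * δ * P₁) := by
    rw [← mul_pow, show x * 2 = 1 + 2 * δ by rw [hδ]; ring]
    exact one_add_pow_le_exp (by linarith) _
  have hL2 : (1 - x)⁻¹ ^ P₂ ≤ 2 ^ P₂ * Real.exp (2 * (2 * δ) * P₂) := by
    rw [show (1 - x)⁻¹ = 2 * (1 - 2 * δ)⁻¹ by
      rw [hδ, ← one_div, ← one_div, mul_one_div, div_eq_div_iff h1x0.ne' (by linarith)]; ring,
      mul_pow]
    exact mul_le_mul_of_nonneg_left (inv_one_sub_pow_le_exp (by linarith) (by linarith) _)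
      (by positivity)
  have hL3 : Real.exp (2 * δ * P₁) * Real.exp (2 * (2 * δ) * P₂) ≤ Real.exp (Λ₀ + 1) := by
    rw [← Real.exp_add, Real.exp_le_exp]
    have hP0 : (0 : ℝ) ≤ (P₁ : ℝ) + 2 * P₂ := by positivity
    have h4P' : ((4 * (P₁ + 2 * P₂) : ℕ) : ℝ) ≤ A := by exact_mod_cast h4P
    push_cast at h4P' hloss
    have hA1 : 2 / (A : ℝ) * (2 * ((P₁ : ℝ) + 2 * P₂)) ≤ 1 := by
      rw [div_mul_eq_mul_div, div_le_one hA0']; linarith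
    have hD1 : 1 / (D : ℝ) * (2 * ((P₁ : ℝ) + 2 * P₂)) ≤ Λ₀ := by
      rw [one_div_mul_eq_div]; exact hloss
    calc 2 * δ * P₁ + 2 * (2 * δ) * P₂ = δ * (2 * ((P₁ : ℝ) + 2 * P₂)) := by ring
      _ ≤ (1 / (D : ℝ) + 2 / A) * (2 * ((P₁ : ℝ) + 2 * P₂)) :=
          mul_le_mul_of_nonneg_right hδhi (by positivity)
      _ = 1 / (D : ℝ) * (2 * ((P₁ : ℝ) + 2 * P₂)) + 2 / (A : ℝ) * (2 * ((P₁ : ℝ) + 2 * P₂)) := by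
          ring
      _ ≤ Λ₀ + 1 := add_le_add hD1 hA1
  -- exponent bookkeeping
  have hid : l' + 2 * nf + P₂ + 2 * r * t = (n + t + P₁) + (l' + 2 * t) := by
    have h1 : ((n + t : ℕ) : ℤ) = ((a + (t + 1) + (t + 1) + (k * (a + (t + 1)) + L') : ℕ) : ℤ) := by
      exact_mod_cast hnt
    have h2 : ((n : ℕ) : ℤ) = ((b + r : ℕ) : ℤ) := by exact_mod_cast hbn
    have h3 : ((r : ℕ) : ℤ) = ((k + 1 : ℕ) : ℤ) := by exact_mod_cast hr
    have h4 : ((l' + 2 * nf + P₂ + 2 * r * t : ℕ) : ℤ) = (((n + t + P₁) + (l' + 2 * t) : ℕ) : ℤ) := by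
      rw [hnf, hP₁, hP₂]; push_cast at h1 h2 h3 ⊢
      linear_combination (-2 : ℤ) * h1 + h2 + (2 + 2 * (t : ℤ)) * h3
    exact_mod_cast h4
  -- final assembly
  have h2P : (0 : ℝ) < 2 ^ P₁ * 2 ^ (2 * r * t) := by positivity
  refine lt_of_mul_lt_mul_right (a := 2 ^ P₁ * 2 ^ (2 * r * t)) ?_ h2P.le
  calc (2 : ℝ) ^ l' * ((r * s + 1) * ρ ^ (r * s)) * θ ^ b *
        (x ^ b * (4 * 3 ^ k) * μ ^ nf * g⁻¹ ^ (2 * k + 2)) ^ 2 *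
        ((1 - x) ^ b * ((1 - x)⁻¹ * (1 + ε')) ^ (n + t)) * (n : ℝ) ^ (r + 1) *
        (2 ^ P₁ * 2 ^ (2 * r * t))
      ≤ 432 * ((r * s + 1) * 2 ^ (4 * k) * (((D : ℝ) / 2) ^ (2 * k + 2)) ^ 2 * (n : ℝ) ^ (r + 1)) *
          2 ^ l' * 2 ^ (2 * nf) * (x ^ P₁ * (1 - x)⁻¹ ^ P₂) * (2 ^ P₁ * 2 ^ (2 * r * t)) :=
        mul_le_mul_of_nonneg_right hLHS h2P.le
    _ = 432 * ((r * s + 1) * 2 ^ (4 * k) * (((D : ℝ) / 2) ^ (2 * k + 2)) ^ 2 * (n : ℝ) ^ (r + 1)) *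
          (2 ^ l' * 2 ^ (2 * nf)) * ((x ^ P₁ * 2 ^ P₁) * (1 - x)⁻¹ ^ P₂) * 2 ^ (2 * r * t) := by
        ring
    _ ≤ 2 ^ (9 + 4 * k + (Lg + 1) * (5 * r + 2)) *
          (2 ^ l' * 2 ^ (2 * nf)) * (Real.exp (2 * δ * P₁) * (2 ^ P₂ * Real.exp (2 * (2 * δ) * P₂))) *
          2 ^ (2 * r * t) := by
        gcongr
    _ = 2 ^ (9 + 4 * k + (Lg + 1) * (5 * r + 2)) * 2 ^ (l' + 2 * nf + P₂ + 2 * r * t) *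
          (Real.exp (2 * δ * P₁) * Real.exp (2 * (2 * δ) * P₂)) := by
        rw [pow_add, pow_add, pow_add]; ring
    _ ≤ 2 ^ (9 + 4 * k + (Lg + 1) * (5 * r + 2)) * 2 ^ (l' + 2 * nf + P₂ + 2 * r * t) *
          Real.exp (Λ₀ + 1) := mul_le_mul_of_nonneg_left hL3 (by positivity)
    _ = (Real.exp (Λ₀ + 1) * 2 ^ (9 + 4 * k + (Lg + 1) * (5 * r + 2) + l' + 2 * t)) *
          2 ^ (n + t + P₁) := by
        rw [hid]; ring
    _ < 2 ^ (2 * r * t) * 2 ^ (n + t + P₁) := mul_lt_mul_of_pos_right hfin (by positivity)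
    _ = 2 ^ (n + t) * (2 ^ P₁ * 2 ^ (2 * r * t)) := by rw [pow_add, pow_add]; ring

/-! ### The side conditions of the closed forms -/

set_option maxHeartbeats 1000000 in
/-- **The analytic side conditions of `Esum_le` and `Lsum_le'`** for
`x ∈ [1/2 + 1/D, 1/2 + 1/D + 2/A]`, `η = 5(D+2)/2^t`, `ε'² 2^t = 16`, gap length `a ≥ t` with
`7 t (D+2) ≤ 20 a` (so `(1 + 2/D)^a ≥ 2^t`), `4t ≤ D`, `8t ≤ A`, `a ≤ 2^t`, `30(D+2) ≤ 2^t`.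
[cite: KumarSaraf2017, §8.5 (proof of Thm. 8.10)] -/
theorem side_conditions {t a D A : ℕ} {x η ε' : ℝ}
    (hxlo : 1 / 2 + 1 / (D : ℝ) ≤ x) (hxhi : x ≤ 1 / 2 + 1 / (D : ℝ) + 2 / (A : ℝ))
    (hD8 : 8 ≤ D) (hA16 : 16 ≤ A) (hD4t : 4 * t ≤ D) (hA8t : 8 * t ≤ A)
    (hDa : (D + 2) * (7 * t) ≤ 20 * a) (hta : t ≤ a) (ha2t : (a : ℝ) ≤ 2 ^ t)
    (hη : η = 5 * ((D : ℝ) + 2) / 2 ^ t) (h30D : 30 * ((D : ℝ) + 2) ≤ 2 ^ t)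
    (hε'0 : 0 < ε') (hε'sq : ε' ^ 2 * 2 ^ t = 16) :
    (0 < x ∧ x ≤ 1 ∧ 0 < η ∧ η ≤ 1 / 2 ∧ x⁻¹ < 2 * (1 + η) ∧
      6 ≤ (2 * (1 + η) - x⁻¹) * η * x⁻¹ ^ t ∧ 2 * (1 + η) - x⁻¹ ≤ 1 ∧
      x⁻¹ ^ (a + min a t) ≤ (2 * (1 + η)) ^ a / (2 * (1 + η) - x⁻¹) ^ 2 ∧
      (a : ℝ) * x⁻¹ ^ (a - 1) ≤ (2 * (1 + η)) ^ a / (2 * (1 + η) - x⁻¹) ^ 2) ∧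
    (0 ≤ x ∧ x < 1 ∧ 2 ≤ (1 - x)⁻¹ ∧ (1 - x)⁻¹ ≤ 4 ∧ 10 ≤ ε' ^ 2 * (1 - x)⁻¹ ^ t) := by
  -- basic real facts
  have hA0' : (0 : ℝ) < A := by exact_mod_cast (show 0 < A by omega)
  have hD0 : 0 < D := by omega
  have hD0' : (0 : ℝ) < D := by exact_mod_cast hD0
  have hD8' : (8 : ℝ) ≤ D := by exact_mod_cast hD8
  have hA16' : (16 : ℝ) ≤ A := by exact_mod_cast hA16
  have hDinv : 1 / (D : ℝ) ≤ 1 / 8 := by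
    rw [div_le_div_iff₀ hD0' (by norm_num)]; linarith
  have hAinv : 2 / (A : ℝ) ≤ 1 / 8 := by
    rw [div_le_div_iff₀ hA0' (by norm_num)]; linarith
  have hDinv0 : (0 : ℝ) < 1 / D := by positivity
  have hAinv0 : (0 : ℝ) ≤ 2 / A := by positivity
  have hx0 : 0 < x := by linarith
  have hx34 : x ≤ 3 / 4 := by linarith
  have hx1 : x < 1 := by linarith
  have h1x0 : 0 < 1 - x := by linarith
  have hx12 : 1 / 2 ≤ x := by linarith
  have h2t : (0 : ℝ) < 2 ^ t := by positivity
  -- θ, μ, g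
  set θ := x⁻¹ with hθ
  have hθ0 : 0 < θ := by rw [hθ]; positivity
  have hθ1 : 1 ≤ θ := by rw [hθ]; exact (one_le_inv₀ hx0).2 hx1.le
  have hθ43 : 4 / 3 ≤ θ := by
    rw [hθ, le_inv_comm₀ (by norm_num) hx0]; norm_num; linarith
  have hθle : θ ≤ 2 * D / (D + 2) := by
    rw [hθ, inv_le_comm₀ hx0 (by positivity), inv_div]
    calc ((D : ℝ) + 2) / (2 * D) = 1 / 2 + 1 / D := by field_simp
      _ ≤ x := hxlo
  have hθ2 : θ < 2 := by
    have : 2 * (D : ℝ) / (D + 2) < 2 := by rw [div_lt_iff₀ (by positivity)]; linarith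
    linarith
  have hη6 : η ≤ 1 / 6 := by
    rw [hη, div_le_iff₀ h2t]; linarith
  have hη0 : 0 < η := by rw [hη]; positivity
  set μ := 2 * (1 + η) with hμ
  have hμ2 : (2 : ℝ) ≤ μ := by rw [hμ]; linarith
  set g := μ - θ with hg
  have hg_lo : 4 / ((D : ℝ) + 2) ≤ g := by
    have h2 : (2 : ℝ) - 2 * D / (D + 2) = 4 / (D + 2) := by field_simp; ring
    rw [hg]; linarith
  have hg0 : 0 < g := lt_of_lt_of_le (by positivity) hg_lo
  have hg1 : g ≤ 1 := by rw [hg, hμ]; linarith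
  have hg2 : g ^ 2 ≤ 1 := pow_le_one₀ hg0.le hg1
  -- `θ^t ≥ 2^t / 3`
  have hθt : (2 : ℝ) ^ t / 3 ≤ θ ^ t := by
    have hu : 2 * x ≤ 1 + (2 / (D : ℝ) + 4 / A) :=
      calc 2 * x ≤ 2 * (1 / 2 + 1 / (D : ℝ) + 2 / (A : ℝ)) := by linarith
        _ = 1 + (2 / (D : ℝ) + 4 / A) := by ring
    have hut : (2 / (D : ℝ) + 4 / A) * t ≤ 1 := by
      have h1 : 2 / (D : ℝ) * t ≤ 1 / 2 := by
        rw [div_mul_eq_mul_div, div_le_iff₀ hD0']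
        have : ((4 * t : ℕ) : ℝ) ≤ D := by exact_mod_cast hD4t
        push_cast at this; linarith
      have h2 : 4 / (A : ℝ) * t ≤ 1 / 2 := by
        rw [div_mul_eq_mul_div, div_le_iff₀ hA0']
        have : ((8 * t : ℕ) : ℝ) ≤ A := by exact_mod_cast hA8t
        push_cast at this; linarith
      linarith [add_mul (2 / (D : ℝ)) (4 / A) (t : ℝ)]
    have h2x : (2 * x) ^ t ≤ 3 :=
      calc (2 * x) ^ t ≤ (1 + (2 / (D : ℝ) + 4 / A)) ^ t :=
            pow_le_pow_left₀ (by positivity) hu t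
        _ ≤ Real.exp ((2 / (D : ℝ) + 4 / A) * t) := one_add_pow_le_exp (by positivity) t
        _ ≤ 3 := exp_le_three hut
    rw [mul_pow] at h2x
    rw [hθ, inv_pow, le_inv_comm₀ (by positivity) (by positivity), inv_div,
      le_div_iff₀ h2t]
    linarith
  -- the `E`-side conditions
  have hE6 : 6 ≤ g * η * θ ^ t := by
    calc (6 : ℝ) ≤ 4 / ((D : ℝ) + 2) * (5 * ((D : ℝ) + 2) / 2 ^ t) * (2 ^ t / 3) := by
          rw [show 4 / ((D : ℝ) + 2) * (5 * ((D : ℝ) + 2) / 2 ^ t) * (2 ^ t / 3) = 20 / 3 by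
            field_simp; ring]
          norm_num
      _ ≤ g * η * θ ^ t := by
          rw [hη]
          exact mul_le_mul (mul_le_mul_of_nonneg_right hg_lo (by positivity)) hθt
            (by positivity) (mul_nonneg hg0.le (by positivity))
  have hkey : (2 * (D : ℝ) / (D + 2)) ^ a * 2 ^ t ≤ 2 ^ a := by
    have h1 : (2 * (D : ℝ) / (D + 2)) = 2 / (1 + 2 / D) := by field_simp
    rw [h1, div_pow, div_mul_eq_mul_div, div_le_iff₀ (by positivity)]
    exact mul_le_mul_of_nonneg_left (two_pow_le_one_add_div_pow hD0 hDa) (by positivity)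
  have hθa : θ ^ a ≤ (2 * (D : ℝ) / (D + 2)) ^ a := pow_le_pow_left₀ hθ0.le hθle a
  have hμa : (2 : ℝ) ^ a ≤ μ ^ a := pow_le_pow_left₀ (by norm_num) hμ2 a
  have hE8 : θ ^ (a + min a t) ≤ μ ^ a / g ^ 2 := by
    rw [min_eq_right hta, le_div_iff₀ (pow_pos hg0 2)]
    calc θ ^ (a + t) * g ^ 2 ≤ θ ^ (a + t) * 1 := by gcongr
      _ = θ ^ a * θ ^ t := by rw [mul_one, pow_add]
      _ ≤ (2 * (D : ℝ) / (D + 2)) ^ a * 2 ^ t :=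
          mul_le_mul hθa (pow_le_pow_left₀ hθ0.le hθ2.le t) (by positivity) (by positivity)
      _ ≤ 2 ^ a := hkey
      _ ≤ μ ^ a := hμa
  have hE9 : (a : ℝ) * θ ^ (a - 1) ≤ μ ^ a / g ^ 2 := by
    rw [le_div_iff₀ (pow_pos hg0 2)]
    have h1 : θ ^ (a - 1) ≤ θ ^ a := pow_le_pow_right₀ hθ1 (Nat.sub_le a 1)
    have h2 : (a : ℝ) * (2 * (D : ℝ) / (D + 2)) ^ a ≤ 2 ^ a := by
      calc (a : ℝ) * (2 * (D : ℝ) / (D + 2)) ^ a ≤ 2 ^ t * (2 * (D : ℝ) / (D + 2)) ^ a :=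
            mul_le_mul_of_nonneg_right ha2t (by positivity)
        _ = (2 * (D : ℝ) / (D + 2)) ^ a * 2 ^ t := mul_comm _ _
        _ ≤ 2 ^ a := hkey
    calc (a : ℝ) * θ ^ (a - 1) * g ^ 2 ≤ (a : ℝ) * θ ^ (a - 1) * 1 := by gcongr
      _ ≤ (a : ℝ) * θ ^ a := by rw [mul_one]; gcongr
      _ ≤ (a : ℝ) * (2 * (D : ℝ) / (D + 2)) ^ a := by gcongr
      _ ≤ 2 ^ a := h2
      _ ≤ μ ^ a := hμa
  -- the `Λ`-side conditions
  have hΛ3 : 2 ≤ (1 - x)⁻¹ := by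
    rw [le_inv_comm₀ (by norm_num) h1x0]; linarith
  have hΛ4 : (1 - x)⁻¹ ≤ 4 := by
    rw [inv_le_comm₀ h1x0 (by norm_num)]; linarith
  have hΛ5 : 10 ≤ ε' ^ 2 * (1 - x)⁻¹ ^ t := by
    calc (10 : ℝ) ≤ 16 := by norm_num
      _ = ε' ^ 2 * 2 ^ t := hε'sq.symm
      _ ≤ ε' ^ 2 * (1 - x)⁻¹ ^ t :=
          mul_le_mul_of_nonneg_left (pow_le_pow_left₀ (by norm_num) hΛ3 t) (by positivity)
  refine ⟨⟨hx0, hx1.le, hη0, by linarith, by linarith, hE6, hg1, hE8, hE9⟩,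
    ⟨hx0.le, hx1, hΛ3, hΛ4, hΛ5⟩⟩

/-! ### The concrete parameters: elementary facts

Throughout `L = ⌊log₂ n⌋`, `R = ⌊√n⌋`, `t = 32 L` (window length `t + 1`), `r = R/8` sites,
support threshold `s = R`, site distance `d = (n-1)/r`, gap `a = d - t - 1`,
`D = 20a/(7t) - 2` (`x ≈ 1/2 + 1/D`), and "`n` large" means `64 ≤ L` and `256 L² + 100 L ≤ R`. -/

/-- **`n ≥ 2^64` is large**: `64 ≤ log₂ n` and `256 (log₂ n)² + 100 log₂ n ≤ √n`. [folklore] -/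
theorem large_of_le {n : ℕ} (hn : 2 ^ 64 ≤ n) :
    64 ≤ Nat.log 2 n ∧ 256 * Nat.log 2 n ^ 2 + 100 * Nat.log 2 n ≤ Nat.sqrt n := by
  set L := Nat.log 2 n with hL
  have hL64 : 64 ≤ L := Nat.le_log_of_pow_le (by norm_num) hn
  refine ⟨hL64, ?_⟩
  have hn0 : n ≠ 0 := by intro h; rw [h] at hn; norm_num at hn
  have h2L : 2 ^ L ≤ n := Nat.pow_log_le_self 2 hn0
  -- `R ≥ 2^{L/2}`
  set j := L / 2 with hj
  have hj32 : 32 ≤ j := by omega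
  have hR : 2 ^ j ≤ Nat.sqrt n := by
    rw [Nat.le_sqrt']
    calc (2 ^ j) ^ 2 = 2 ^ (2 * j) := by rw [← pow_mul, mul_comm]
      _ ≤ 2 ^ L := Nat.pow_le_pow_right (by norm_num) (by omega)
      _ ≤ n := h2L
  -- `2^j ≥ (2j+2)² · 2^{j-16}·... `: use `2^j = 2^16 · 2^{j-16} ≥ 2^16 (j-16)²`
  -- `i² ≤ 2^i` for `i ≥ 4` (also `OddZeta.sq_le_two_pow` in the tree; re-proved to keep imports light)
  have hsq : ∀ i : ℕ, 4 ≤ i → i ^ 2 ≤ 2 ^ i := by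
    intro i hi
    induction i, hi using Nat.le_induction with
    | base => norm_num
    | succ i hi ih =>
      have : (i + 1) ^ 2 ≤ 2 * i ^ 2 := by nlinarith
      calc (i + 1) ^ 2 ≤ 2 * i ^ 2 := this
        _ ≤ 2 * 2 ^ i := by omega
        _ = 2 ^ (i + 1) := by ring
  have hj' : (j - 16) ^ 2 ≤ 2 ^ (j - 16) := hsq _ (by omega)
  have hpow : 2 ^ j = 2 ^ 16 * 2 ^ (j - 16) := by rw [← pow_add]; congr 1; omega
  have hL2j : L ≤ 2 * j + 1 := by omega
  calc 256 * L ^ 2 + 100 * L ≤ 256 * (2 * j + 1) ^ 2 + 100 * (2 * j + 1) := by gcongr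
    _ ≤ 2 ^ 16 * (j - 16) ^ 2 := by
        have h16 : 16 ≤ j - 16 := by omega
        obtain ⟨i, hi⟩ : ∃ i, j - 16 = i := ⟨_, rfl⟩
        have hji : j = i + 16 := by omega
        rw [hi, hji]
        rw [hi] at h16
        nlinarith
    _ ≤ 2 ^ 16 * 2 ^ (j - 16) := Nat.mul_le_mul_left _ hj'
    _ = 2 ^ j := hpow.symm
    _ ≤ Nat.sqrt n := hR

/-- **Facts about `r`, `s = R`, `d`** for large `n`. [folklore] -/
theorem facts_rsd {n L R t r d : ℕ} (hRn : R ^ 2 ≤ n) (hnR : n < (R + 1) ^ 2)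
    (hL : 64 ≤ L) (hR : 256 * L ^ 2 + 100 * L ≤ R) (ht : t = 32 * L) (hr : r = R / 8)
    (hd : d = (n - 1) / r) :
    1024 ≤ r ∧ 8 * r ≤ R ∧ R ≤ 8 * r + 7 ∧ R ≤ n ∧ t ≤ R ∧ 8 * (r * R) ≤ n ∧
      r * d ≤ n - 1 ∧ n - r ≤ r * d ∧ 2 * t ^ 2 + 3 * t + 1 ≤ d ∧ 80 * (r + 2 * t) ≤ n ∧
      r * (41 * t + 40) ≤ 2 * n ∧ 2 * n / R ≤ 2 * R + 4 := by
  have hL2 : 64 * L ≤ L ^ 2 := by nlinarith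
  have hRbig : 256 * 64 * L ≤ R := by nlinarith
  have hr1024 : 1024 ≤ r := by omega
  have h8r : 8 * r ≤ R := by omega
  have hR8r : R ≤ 8 * r + 7 := by omega
  have hRR : R * R ≤ n := by nlinarith
  have hRn' : R ≤ n := le_trans (Nat.le_mul_self R) hRR
  have htR : t ≤ R := by omega
  have hrR : 8 * (r * R) ≤ n := by
    calc 8 * (r * R) = (8 * r) * R := by ring
      _ ≤ R * R := Nat.mul_le_mul_right R h8r
      _ ≤ n := hRR
  have hr0 : 0 < r := by omega
  have hrd : r * d ≤ n - 1 := by rw [hd]; exact Nat.mul_div_le (n - 1) r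
  have hrd' : n - r ≤ r * d := by
    have := Nat.lt_div_mul_add (a := n - 1) hr0
    rw [← hd] at this
    have : n - 1 < r * d + r := by linarith [mul_comm d r]
    omega
  have hd8R : 8 * R ≤ d + 1 := by
    have h1 : R * (8 * R) ≤ R * (d + 1) := by
      calc R * (8 * R) = 8 * (R * R) := by ring
        _ ≤ 8 * n := by omega
        _ ≤ 8 * (r * d) + 8 * r := by omega
        _ = (8 * r) * d + 8 * r := by ring
        _ ≤ R * d + R := by
            have := Nat.mul_le_mul_right d h8r
            omega
        _ = R * (d + 1) := by ring
    exact Nat.le_of_mul_le_mul_left h1 (by omega)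
  have ht2 : t ^ 2 = 1024 * L ^ 2 := by rw [ht]; ring
  have hd2 : 2 * t ^ 2 + 3 * t + 1 ≤ d := by
    rw [ht2]; omega
  have h80 : 80 * (r + 2 * t) ≤ n := by
    -- `80 (r + 2t) ≤ 10 R + 5120 L ≤ R (10 + 5120 L) ≤ R · R ≤ n`
    have h1 : 80 * (r + 2 * t) ≤ 10 * R + 5120 * L := by omega
    have h2 : 10 + 5120 * L ≤ R := by nlinarith
    calc 80 * (r + 2 * t) ≤ 10 * R + 5120 * L := h1
      _ ≤ 10 * R + 5120 * L * R := by nlinarith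
      _ = R * (10 + 5120 * L) := by ring
      _ ≤ R * R := Nat.mul_le_mul_left R h2
      _ ≤ n := hRR
  have h41 : r * (41 * t + 40) ≤ 2 * n := by
    -- `r (41 t + 40) ≤ (R/8)(1312 L + 40) ≤ R (164 L + 5) ≤ R · R ≤ n ≤ 2n`
    have h1 : 8 * (r * (41 * t + 40)) ≤ R * (1312 * L + 40) := by
      calc 8 * (r * (41 * t + 40)) = (8 * r) * (41 * t + 40) := by ring
        _ ≤ R * (41 * t + 40) := Nat.mul_le_mul_right _ h8r
        _ = R * (1312 * L + 40) := by rw [ht]; ring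
    have h2 : 1312 * L + 40 ≤ 8 * R := by nlinarith
    have h3 : R * (1312 * L + 40) ≤ R * (8 * R) := Nat.mul_le_mul_left R h2
    nlinarith
  have hl : 2 * n / R ≤ 2 * R + 4 := by
    apply Nat.div_le_of_le_mul
    nlinarith
  exact ⟨hr1024, h8r, hR8r, hRn', htR, hrR, hrd, hrd', hd2, h80, h41, hl⟩

/-- **Facts about `D = 20a/(7t) - 2`** for `a ≥ 2t² + 2t`, `t ≥ 3`. [folklore] -/
theorem facts_D {t a D : ℕ} (ht : 3 ≤ t) (ha : 2 * t ^ 2 + 2 * t ≤ a)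
    (hD : D = 20 * a / (7 * t) - 2) :
    (D + 2) * (7 * t) ≤ 20 * a ∧ 20 * a < (D + 3) * (7 * t) ∧ 4 * t ≤ D ∧ 8 ≤ D ∧ D ≤ a := by
  set q := 20 * a / (7 * t) with hq
  have h7t : 0 < 7 * t := by omega
  have hq1 : 4 * t + 2 ≤ q := by
    rw [hq, Nat.le_div_iff_mul_le h7t]
    nlinarith
  have hDq : D + 2 = q := by omega
  have h1 : q * (7 * t) ≤ 20 * a := Nat.div_mul_le_self _ _
  have h2 : 20 * a < q * (7 * t) + 7 * t := Nat.lt_div_mul_add h7t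
  have hqa : q ≤ a := by
    rw [hq]; apply Nat.div_le_of_le_mul; nlinarith
  refine ⟨by rw [hDq]; exact h1, ?_, by omega, by omega, by omega⟩
  calc 20 * a < q * (7 * t) + 7 * t := h2
    _ = (D + 3) * (7 * t) := by rw [show D + 3 = q + 1 by omega]; ring

/-- **Powers of two**: `n < 2^{L+1}`, `64 n² ≤ 2^{32L}`, `16 n ≤ 2^{16 L}` (`L = log₂ n ≥ 1`).
[folklore] -/
theorem facts_pow {n L : ℕ} (hnL : n < 2 ^ (L + 1)) (hL : 1 ≤ L) :
    64 * n ^ 2 ≤ 2 ^ (32 * L) ∧ 16 * n ≤ 2 ^ (16 * L) := by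
  have hn : n ≤ 2 ^ (L + 1) := hnL.le
  constructor
  · calc 64 * n ^ 2 ≤ 64 * (2 ^ (L + 1)) ^ 2 := by gcongr
      _ = 2 ^ (2 * L + 8) := by rw [← pow_mul]; rw [show 64 = 2 ^ 6 by norm_num, ← pow_add]; ring_nf
      _ ≤ 2 ^ (32 * L) := Nat.pow_le_pow_right (by norm_num) (by omega)
  · calc 16 * n ≤ 16 * 2 ^ (L + 1) := by gcongr
      _ = 2 ^ (L + 5) := by rw [show 16 = 2 ^ 4 by norm_num, ← pow_add]; ring_nf
      _ ≤ 2 ^ (16 * L) := Nat.pow_le_pow_right (by norm_num) (by omega)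

/-- **Facts about the shift degree `m = A/2 - A/D - 1`** (`D ≥ 8`, `3A ≥ 8b + 16`): the ranges of
`m` and of `x = (A - m)/A ∈ [1/2 + 1/D, 1/2 + 1/D + 2/A]`. [folklore] -/
theorem facts_m {A D b m : ℕ} (hD8 : 8 ≤ D) (hAb : 8 * b + 16 ≤ 3 * A) (hm : m = A / 2 - A / D - 1) :
    0 < m ∧ 2 * m ≤ A ∧ m < A ∧ b ≤ m ∧ m + b ≤ A ∧
      1 / 2 + 1 / (D : ℝ) ≤ ((A : ℝ) - m) / A ∧
      ((A : ℝ) - m) / A ≤ 1 / 2 + 1 / (D : ℝ) + 2 / (A : ℝ) := by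
  have hD0 : 0 < D := by omega
  have hqD8 : A / D ≤ A / 8 := Nat.div_le_div_left hD8 (by norm_num)
  have h2a : 2 * (A / 2) ≤ A := Nat.mul_div_le A 2
  have h2b : A < 2 * (A / 2) + 2 := Nat.lt_mul_div_succ A (by norm_num)
  have hDa : D * (A / D) ≤ A := Nat.mul_div_le A D
  have hDb : A < D * (A / D) + D := Nat.lt_mul_div_succ A hD0
  generalize A / D = qD at *
  generalize A / 2 = q2 at *
  have hm' : m + qD + 1 = q2 := by omega
  refine ⟨by omega, by omega, by omega, by omega, by omega, ?_, ?_⟩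
  · -- lower bound: `A - m = A - q2 + qD + 1 ≥ A/2 + A/D`
    have hA0 : (0 : ℝ) < A := by exact_mod_cast (show 0 < A by omega)
    have hD0' : (0 : ℝ) < D := by exact_mod_cast hD0
    rw [div_add_div _ _ (two_ne_zero) hD0'.ne', div_le_div_iff₀ (by positivity) hA0]
    have e1 : ((m : ℕ) : ℝ) + qD + 1 = q2 := by exact_mod_cast hm'
    have e2 : 2 * (q2 : ℝ) ≤ A := by exact_mod_cast h2a
    have e3 : (A : ℝ) ≤ D * qD + D := by exact_mod_cast hDb.le
    nlinarith
  · -- upper bound: `A - m ≤ A/2 + 1/2 + A/D + 1`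
    have hA0 : (0 : ℝ) < A := by exact_mod_cast (show 0 < A by omega)
    have hD0' : (0 : ℝ) < D := by exact_mod_cast hD0
    have e1 : ((m : ℕ) : ℝ) + qD + 1 = q2 := by exact_mod_cast hm'
    have e2 : (A : ℝ) ≤ 2 * (q2 : ℝ) + 1 := by exact_mod_cast (by omega : A ≤ 2 * q2 + 1)
    have e3 : (D : ℝ) * qD ≤ A := by exact_mod_cast hDa
    have : ((A : ℝ) - m) / A ≤ (1 / 2 + 1 / (D : ℝ) + 2 / (A : ℝ)) ↔
        ((A : ℝ) - m) * (2 * D) ≤ (D + 2 + 4 * D / A) * A := by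
      rw [show (1 / 2 + 1 / (D : ℝ) + 2 / (A : ℝ)) = (D + 2 + 4 * D / A) / (2 * D) by
        field_simp; ring]
      exact div_le_div_iff₀ hA0 (by positivity)
    rw [this, show ((D : ℝ) + 2 + 4 * D / A) * A = (D + 2) * A + 4 * D by field_simp]
    nlinarith

/-- **The loss estimate `12 (P₁ + 2 P₂) ≤ 7 r t D`** (`P₁ = rs + b`, `P₂ = rs + r + t`,
`n = b + r`), from `r a + r t + r = r d ≥ n - r`... i.e. `D ≈ 20 a/(7t)`, `r a ≈ n`. [folklore] -/
theorem loss_nat {n r s t d a D b : ℕ} (hbn : n = b + r) (had : a + t + 1 = d)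
    (hrd : n - r ≤ r * d) (hDlt : 20 * a < (D + 3) * (7 * t)) (hrs : 8 * (r * s) ≤ n)
    (h80 : 80 * (r + 2 * t) ≤ n) (h41 : r * (41 * t + 40) ≤ 2 * n) :
    12 * ((r * s + b) + 2 * (r * s + r + t)) ≤ 7 * (r * t) * D := by
  have F1 : r * a + r * t + r = r * d := by rw [← had]; ring
  have F2 : b ≤ r * d := by omega
  have F3 : 20 * (r * a) ≤ 7 * (r * t * D) + 21 * (r * t) := by
    have := Nat.mul_le_mul_left r hDlt.le
    nlinarith
  nlinarith

/-- **The final exponent comparison** (`t = 32 L`, `k + 1 = r`, `l' ≤ 16 r + 19`, `L ≥ 64`,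
`r ≥ 1024`): the bracket `9 + 4k + (L+1)(5r+2) + l' + 2t` is `≤ 2 r t` and
`10⁴ (7 r t / 6 + 1) < 6931 (2 r t - bracket)` (cleared of denominators). [folklore] -/
theorem fin_nat {L t r k l' : ℕ} (ht : t = 32 * L) (hr : r = k + 1) (hl' : l' ≤ 16 * r + 19)
    (hL : 64 ≤ L) (hr1024 : 1024 ≤ r) :
    9 + 4 * k + (L + 1) * (5 * r + 2) + l' + 2 * t ≤ 2 * r * t ∧
      41586 * (9 + 4 * k + (L + 1) * (5 * r + 2) + l' + 2 * t) + 60000 + 70000 * (r * t) <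
        83172 * (r * t) := by
  have e1 : (L + 1) * (5 * r + 2) = 5 * (r * L) + 5 * r + 2 * L + 2 := by ring
  have e2 : r * t = 32 * (r * L) := by rw [ht]; ring
  have e3 : 2 * r * t = 64 * (r * L) := by rw [ht]; ring
  have h1 : 64 * r ≤ r * L := by nlinarith
  have h2 : 1024 * L ≤ r * L := by nlinarith
  rw [e1, e2, e3]
  constructor <;> omega

end SlidingWindow

end Literature.Computability.AlgebraicComplexity
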